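import Mathlib.Combinatorics.Hall.Basic
import Mathlib.Logic.Equiv.Basic
import Mathlib.Data.Fintype.Card
import Mathlib.Data.Finset.Card
import Mathlib.Tactic

/-!
# Route «KPlusLogSqLaw», crux `TropicalB` (stmt-ValiantsHypothesis-19771) — the TWO-SIGNAL LAW:
# a block that can show a row hole and a column hole FAITHFULLY (no lying hole pair in its support) is a bare matching

HONEST FRAMING.  Helper toward the registered stubs `stub_tropThin` / `stub_tropFat` of `Cruxes/TropicalB/Lines/birth.lean` (crux
`Summit.ValiantsHypothesis.ValiantsHypothesis.Theses.KPlusLogSqLaw.TropicalB`, item stmt-ValiantsHypothesis-19771, route KPlusLogSqLaw;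
cell `pub-symmetroid`, seat val-sym-trop-p5 g15, refuter-adjacent lane, 2026-08-28; `--supports … --as helper`).  A COMBINATORIAL
no-go lemma about bipartite supports (Hall's theorem + one alternating 3-exchange); it bounds nothing by itself and says nothing about
`TropicalB` in its window, `WeakLifting`, DoorA26 / DoorA34, `MatrixDescartes` (stmt-ValiantsHypothesis-18050) or VP ≠ VNP.

WHY (architecture census of the cell, K = 4 «third digit»).  A convex chain `V = F(S)` over three registers `a, b, c` with additive
slope `S = P₁a + P₂b + P₃c` needs all three mixed second differences of `V` non-zero (a vanishing one puts four dominant terms in a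
parallelogram, `ExchangeSquare.not_dominant_square`), so a pairwise-interaction architecture needs a TRIANGLE of couplings, i.e. every
register must expose TWO signals.  The cell's opposite-side coupling (row hole of one register against the column hole of another
through one cell, `…TropicalBCoupledRegisters`, the `K = 3` product) is the only coupling known to carry a full product
(same-side pairs cannot: `RegisterPair.registerPair_law`), so each register of a triangle has to present a ROW hole to one neighbour
and a COLUMN hole to the other, both encoding its state.  This file shows that no block support can do that rigidly:

* `TwoSignal.edge_iff_of_perfect` — if the block support `G ⊆ X × Y` (`|X| = |Y|`) has a perfect matching `τ` and the feasible
  hole pairs are COLUMN-FAITHFUL (a row is the row hole of feasible near-perfect matchings with at most one column hole), then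
  `G` is the graph of `τ`: one extra cell `(r, c)`, `c ≠ τ r`, makes the row `τ⁻¹ c` the partner of both `c` and `τ r`
  (3-edge alternating exchange).
* `TwoSignal.lying_pair_of_no_perfect` — if `G` has NO perfect matching and `(x, y)`, `(x', y')` are feasible hole pairs, then the
  recombined pair `(x, y')` is feasible too (a LYING pair when `x ≠ x'`): a Hall violator `S` (Mathlib's
  `Fintype.all_card_le_filter_rel_iff_exists_injective`) contains every hole row, its neighbourhood misses every hole column, and
  the two near-perfect matchings recombine across `S` (König independence of the two sides, done by hand).
* `TwoSignal.two_signal_law` — hence: if the feasible hole pairs of `G` are faithful in BOTH coordinates and there are two of them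
  with different rows, `G` is a bare matching; `TwoSignal.holePair_iff` — and then the feasible pairs are exactly `(a, τ a)` and every
  near-perfect matching is `τ` minus one cell.  So a structurally rigid two-signal register shows configurations that differ from
  one another in a single cell: at most `K` distinct class histograms, never a digit of a growing range.  Registers whose support
  does contain lying pairs are not excluded by this file; for them the lying configurations are present competitors (LOCATED,
  seat tools `tools/holetri.py`, `tools/holepair.py` with val-sym-trop-p1's LP oracle `lpreal.realize`, all valuations free:
  rotation-minus-a-cell registers coupled in a square (2 registers, n = 4, 6) or a triangle (3 registers, n = 4, 27 states, m = 15)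
  are LP-infeasible in 0.4 s / 16 s / 9 s — seat memo TWO-SIGNAL-g15.md).
[folklore: Hall 1935; alternating-path exchange; the packaging («two-signal law») is the cell's]
-/

set_option linter.dupNamespace false
set_option autoImplicit false

namespace Summit.ValiantsHypothesis.ValiantsHypothesis.Theorems.KPlusLogSqLaw.TwoSignal

open Finset Function

variable {α β : Type*}

/-- **Perfect case.**  If the support `G` has a perfect matching `τ` and its feasible hole pairs
(`(x, y)` is FEASIBLE when some bijection `σ : α ≃ β` with `σ x = y` uses only cells of `G` off the row `x` — i.e.
`G` minus row `x` and column `y` has a perfect matching) are column-faithful, then `G` is exactly the graph of `τ`.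
[folklore: 3-edge alternating exchange] -/
theorem edge_iff_of_perfect [DecidableEq α] (G : α → β → Prop) (τ : α ≃ β) (hτ : ∀ a, G a (τ a))
    (hcol : ∀ (x : α) (y y' : β),
      (∃ σ : α ≃ β, σ x = y ∧ ∀ a, a ≠ x → G a (σ a)) →
      (∃ σ : α ≃ β, σ x = y' ∧ ∀ a, a ≠ x → G a (σ a)) → y = y') :
    ∀ a b, G a b ↔ b = τ a := by
  intro r c
  constructor
  · intro hrc
    -- the row `r₂ = τ⁻¹ c` is the hole row of `τ` minus `(r₂, c)` (hole column `c`) and of the exchanged matching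
    -- `τ ∘ swap r r₂` minus its `r₂`-cell (hole column `τ r`)
    set r₂ := τ.symm c with hr₂
    have h1 : ∃ σ : α ≃ β, σ r₂ = c ∧ ∀ a, a ≠ r₂ → G a (σ a) :=
      ⟨τ, by simp [hr₂], fun a _ => hτ a⟩
    have h2 : ∃ σ : α ≃ β, σ r₂ = τ r ∧ ∀ a, a ≠ r₂ → G a (σ a) := by
      refine ⟨(Equiv.swap r r₂).trans τ, ?_, ?_⟩
      · simp [Equiv.swap_apply_right]
      · intro a ha
        by_cases har : a = r
        · subst har
          simp only [Equiv.trans_apply, Equiv.swap_apply_left]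
          have : τ r₂ = c := by simp [hr₂]
          rw [this]; exact hrc
        · simp only [Equiv.trans_apply]
          rw [Equiv.swap_apply_of_ne_of_ne har ha]
          exact hτ a
    have := hcol r₂ c (τ r) h1 h2
    exact this
  · rintro rfl
    exact hτ r

/-- **Deficient case.**  If the support `G` has NO perfect matching and the hole pairs `(x, y)` and `(x', y')` are feasible,
then the recombined pair `(x, y')` is feasible as well (for `x ≠ x'`, `y ≠ y'` a LYING pair).  [folklore: Hall's theorem; recombination across a Hall violator] -/
theorem lying_pair_of_no_perfect [Fintype α] [Fintype β] [DecidableEq α] [DecidableEq β]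
    (G : α → β → Prop) [DecidableRel G]
    (hno : ¬ ∃ τ : α ≃ β, ∀ a, G a (τ a))
    {x x' : α} {y y' : β}
    (h1 : ∃ σ : α ≃ β, σ x = y ∧ ∀ a, a ≠ x → G a (σ a))
    (h2 : ∃ σ : α ≃ β, σ x' = y' ∧ ∀ a, a ≠ x' → G a (σ a)) :
    ∃ σ : α ≃ β, σ x = y' ∧ ∀ a, a ≠ x → G a (σ a) := by
  classical
  obtain ⟨σ, hσx, hσ⟩ := h1
  obtain ⟨σ', hσx', hσ'⟩ := h2
  have hcard : Fintype.card α = Fintype.card β := Fintype.card_congr σ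
  -- no perfect matching ⇒ no injective transversal ⇒ a Hall violator `S`
  have hnotinj : ¬ ∃ f : α → β, Injective f ∧ ∀ a, G a (f a) := by
    rintro ⟨f, hf, hfG⟩
    have hbij : Bijective f := (Fintype.bijective_iff_injective_and_card f).2 ⟨hf, hcard⟩
    exact hno ⟨Equiv.ofBijective f hbij, fun a => hfG a⟩
  rw [← Fintype.all_card_le_filter_rel_iff_exists_injective G] at hnotinj
  push Not at hnotinj
  obtain ⟨S, hS⟩ := hnotinj
  set N : Finset β := ({b | ∃ a ∈ S, G a b} : Finset β) with hN
  -- every hole row lies in `S`, and the image of `S` minus the hole row is exactly `N`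
  have key : ∀ (ρ : α ≃ β) (z : α), (∀ a, a ≠ z → G a (ρ a)) →
      z ∈ S ∧ (S.erase z).image ρ = N := by
    intro ρ z hρ
    have hsub : (S.erase z).image ρ ⊆ N := by
      intro b hb
      rw [Finset.mem_image] at hb
      obtain ⟨a, ha, rfl⟩ := hb
      rw [Finset.mem_erase] at ha
      rw [hN, Finset.mem_filter]
      exact ⟨Finset.mem_univ _, a, ha.2, hρ a ha.1⟩
    have hcardim : ((S.erase z).image ρ).card = (S.erase z).card :=
      Finset.card_image_of_injective _ ρ.injective
    have hz : z ∈ S := by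
      by_contra hz
      have : S.erase z = S := Finset.erase_eq_of_notMem hz
      have hle := Finset.card_le_card hsub
      rw [hcardim, this] at hle
      omega
    refine ⟨hz, Finset.eq_of_subset_of_card_le hsub ?_⟩
    rw [hcardim, Finset.card_erase_of_mem hz]
    omega
  obtain ⟨hxS, himσ⟩ := key σ x hσ
  obtain ⟨hx'S, himσ'⟩ := key σ' x' hσ'
  -- `y' = σ' x'` is not in `N`
  have hy'N : y' ∉ N := by
    intro hy
    rw [← himσ', Finset.mem_image] at hy
    obtain ⟨a, ha, hay⟩ := hy
    rw [Finset.mem_erase] at ha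
    rw [← hσx'] at hay
    exact ha.1 (σ'.injective hay)
  -- the recombined map
  let f : α → β := fun a => if a = x then y' else if a ∈ S then σ a else σ' a
  have hfS : ∀ a, a ∈ S → a ≠ x → f a ∈ N := by
    intro a haS hax
    simp only [f, if_neg hax, if_pos haS]
    rw [← himσ, Finset.mem_image]
    exact ⟨a, Finset.mem_erase.2 ⟨hax, haS⟩, rfl⟩
  have hfout : ∀ a, a ∉ S → f a ∉ N ∧ f a ≠ y' := by
    intro a haS
    have hax : a ≠ x := fun h => haS (h ▸ hxS)
    have hax' : a ≠ x' := fun h => haS (h ▸ hx'S)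
    simp only [f, if_neg hax, if_neg haS]
    constructor
    · intro hmem
      rw [← himσ', Finset.mem_image] at hmem
      obtain ⟨a₀, ha₀, heq⟩ := hmem
      rw [Finset.mem_erase] at ha₀
      have : a₀ = a := σ'.injective heq
      exact haS (this ▸ ha₀.2)
    · intro heq
      rw [← hσx'] at heq
      exact hax' (σ'.injective heq)
  have hinj : Injective f := by
    intro a₁ a₂ h
    by_cases h₁ : a₁ = x
    · by_cases h₂ : a₂ = x
      · rw [h₁, h₂]
      · exfalso
        have hfa₁ : f a₁ = y' := by simp only [f, if_pos h₁]
        by_cases h₂S : a₂ ∈ S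
        · have := hfS a₂ h₂S h₂; rw [← h, hfa₁] at this; exact hy'N this
        · exact (hfout a₂ h₂S).2 (h ▸ hfa₁)
    · by_cases h₂ : a₂ = x
      · exfalso
        have hfa₂ : f a₂ = y' := by simp only [f, if_pos h₂]
        by_cases h₁S : a₁ ∈ S
        · have := hfS a₁ h₁S h₁; rw [h, hfa₂] at this; exact hy'N this
        · exact (hfout a₁ h₁S).2 (h.symm ▸ hfa₂)
      · by_cases h₁S : a₁ ∈ S
        · by_cases h₂S : a₂ ∈ S
          · have e₁ : f a₁ = σ a₁ := by simp only [f, if_neg h₁, if_pos h₁S]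
            have e₂ : f a₂ = σ a₂ := by simp only [f, if_neg h₂, if_pos h₂S]
            rw [e₁, e₂] at h
            exact σ.injective h
          · exfalso
            have := hfS a₁ h₁S h₁; rw [h] at this; exact (hfout a₂ h₂S).1 this
        · by_cases h₂S : a₂ ∈ S
          · exfalso
            have := hfS a₂ h₂S h₂; rw [← h] at this; exact (hfout a₁ h₁S).1 this
          · have e₁ : f a₁ = σ' a₁ := by simp only [f, if_neg h₁, if_neg h₁S]
            have e₂ : f a₂ = σ' a₂ := by simp only [f, if_neg h₂, if_neg h₂S]
            rw [e₁, e₂] at h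
            exact σ'.injective h
  have hbij : Bijective f := (Fintype.bijective_iff_injective_and_card f).2 ⟨hinj, hcard⟩
  refine ⟨Equiv.ofBijective f hbij, ?_, ?_⟩
  · simp [f]
  · intro a hax
    simp only [Equiv.ofBijective_apply]
    by_cases haS : a ∈ S
    · simp only [f, if_neg hax, if_pos haS]; exact hσ a hax
    · have hax' : a ≠ x' := fun h => haS (h ▸ hx'S)
      simp only [f, if_neg hax, if_neg haS]; exact hσ' a hax'

/-- **TWO-SIGNAL LAW.**  If the feasible hole pairs of a support `G` are faithful in both coordinates (a hole row determines the
hole column and conversely) and two of them have different hole rows, then `G` is a bare perfect matching.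
[folklore: Hall + alternating exchange; packaging this cell] -/
theorem two_signal_law [Fintype α] [Fintype β] [DecidableEq α] [DecidableEq β]
    (G : α → β → Prop) [DecidableRel G]
    (hcol : ∀ (x : α) (y y' : β),
      (∃ σ : α ≃ β, σ x = y ∧ ∀ a, a ≠ x → G a (σ a)) →
      (∃ σ : α ≃ β, σ x = y' ∧ ∀ a, a ≠ x → G a (σ a)) → y = y')
    (hrow : ∀ (x x' : α) (y : β),
      (∃ σ : α ≃ β, σ x = y ∧ ∀ a, a ≠ x → G a (σ a)) →
      (∃ σ : α ≃ β, σ x' = y ∧ ∀ a, a ≠ x' → G a (σ a)) → x = x')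
    {x x' : α} {y y' : β} (hxx : x ≠ x')
    (h1 : ∃ σ : α ≃ β, σ x = y ∧ ∀ a, a ≠ x → G a (σ a))
    (h2 : ∃ σ : α ≃ β, σ x' = y' ∧ ∀ a, a ≠ x' → G a (σ a)) :
    ∃ τ : α ≃ β, ∀ a b, G a b ↔ b = τ a := by
  by_cases hpm : ∃ τ : α ≃ β, ∀ a, G a (τ a)
  · obtain ⟨τ, hτ⟩ := hpm
    exact ⟨τ, edge_iff_of_perfect G τ hτ hcol⟩
  · exfalso
    have h3 := lying_pair_of_no_perfect G hpm h1 h2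
    have hyy : y = y' := hcol x y y' h1 h3
    subst hyy
    exact hxx (hrow x x' y h1 h2)

/-- **Reading.**  When the support is the graph of `τ`, the feasible hole pairs are exactly the cells `(a, τ a)` and every
near-perfect matching is `τ` off its hole row: the block's configurations differ from one another in ONE cell.  [elementary] -/
theorem holePair_iff (G : α → β → Prop) (τ : α ≃ β) (hG : ∀ a b, G a b ↔ b = τ a) (x : α) (y : β) :
    (∃ σ : α ≃ β, σ x = y ∧ ∀ a, a ≠ x → G a (σ a)) ↔ y = τ x := by
  constructor
  · rintro ⟨σ, hσx, hσ⟩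
    -- `σ` agrees with `τ` off `x`, hence at `x` as well
    have hoff : ∀ a, a ≠ x → σ a = τ a := fun a ha => (hG a (σ a)).1 (hσ a ha)
    have : σ x = τ x := by
      by_contra hne
      have hsurj := σ.surjective (τ x)
      obtain ⟨a, ha⟩ := hsurj
      by_cases hax : a = x
      · exact hne (hax ▸ ha)
      · rw [hoff a hax] at ha
        exact hax (τ.injective ha)
    rw [← hσx, this]
  · rintro rfl
    exact ⟨τ, rfl, fun a _ => (hG a (τ a)).2 rfl⟩

/-- the configuration (near-perfect matching) showing the hole row `x` is unique: it is `τ` off `x`. [elementary] -/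
theorem config_eq (G : α → β → Prop) (τ : α ≃ β) (hG : ∀ a b, G a b ↔ b = τ a) (x : α)
    (σ : α ≃ β) (hσ : ∀ a, a ≠ x → G a (σ a)) : ∀ a, a ≠ x → σ a = τ a :=
  fun a ha => (hG a (σ a)).1 (hσ a ha)

end Summit.ValiantsHypothesis.ValiantsHypothesis.Theorems.KPlusLogSqLaw.TwoSignal
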